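import Mathlib.LinearAlgebra.Dual.Lemmas
import Mathlib.RingTheory.LocalRing.Module
import Mathlib.RingTheory.Flat.Basic
import Mathlib.Algebra.Homology.ShortComplex.ModuleCat
import Mathlib.CategoryTheory.Abelian.Projective.Dimension
import Mathlib.Algebra.Category.ModuleCat.Projective
import Mathlib.Algebra.Category.ModuleCat.Abelian
import Literature.AlgebraicGeometry.Resolution.RegularLocalRingsProofs
import HarnessLib

/-!
# Reflexive modules, duals and second syzygies over a regular local ring of dimension `≤ 2` are free
# (input (F0) of the G-layer of chain W4.4)

`[OURS · L W4.4]` Crux `HomologicalConductor.NoZenoR` (stmt-ResolutionOfSingularities-19943; twin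
`NoZeno` stmt-ResolutionOfSingularities-16483), line `sandwich-cluster`, S3 Layer 2 = THEOREM A at sky
points (`stub_skyPrincipal`).  The G-layer of the crux plan (res-L0-w44-plan-1 CRUX-PLAN v6 §B, after
res-L0-w44-idea-1's THEOREM Q-rat §1 (F0) / §3 (B1), (B3)) uses at every SKY POINT `S` of the stage —
a two-dimensional REGULAR local ring — that reflexive hulls of full sheaves, their duals and the kernels
of their evaluation sequences are locally free: «on a regular surface every reflexive coherent sheaf is
locally free».  This file is the scheme-free commutative algebra behind that sentence, in the form both
candidate formalisms of the G-layer (tree scheme vocabulary / bespoke sky-Čech) consume: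

* `projective_ker_of_hasProjectiveDimensionLT_three` — over any commutative ring, the kernel of a linear
  map `φ : F₁ → F₀` between projective modules whose cokernel has projective dimension `≤ 2` is
  projective (two dimension shifts, Mathlib `ShortExact.hasProjectiveDimensionLT_X₁`);
* `hasProjectiveDimensionLE_of_isRegularLocalRing` — over a regular local ring of Krull dimension `≤ d`
  every finite module has projective dimension `≤ d` (the tree's Matsumura Thm. 19.2 (I),
  `hasProjectiveDimensionLE_length_of_isWeaklyRegular`, on a regular system of parameters,
  `exists_isRegular_ofList_eq_maximalIdeal`);
* `free_ker_of_isRegularLocalRing` — SECOND SYZYGIES: the kernel of a linear map between finite free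
  modules over a regular local ring of dimension `≤ 2` is free;
* `free_dual_of_isRegularLocalRing` — the DUAL `M* = Hom(M, R)` of every finite module over such a
  ring is free (`M*` is the kernel of the dual of a presentation);
* `free_of_isReflexive_of_isRegularLocalRing` — **(F0)** every finite REFLEXIVE module
  (`Module.IsReflexive`: `M → M**` bijective) over a regular local ring of dimension `≤ 2` is free.

Replaces the role of no printed item of the manuscript under review (Hironaka 2017); textbook
commutative algebra (Auslander–Buchsbaum–Serre; Bruns–Herzog, *Cohen–Macaulay rings* (rev. ed.
1998), Prop. 1.4.1 and Thm. 2.2.7; Matsumura, *Commutative Ring Theory*, Thm. 19.2); AI-written, weaker than expert review.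
-/

-- single-problem summit: the doubled namespace component `ResolutionOfSingularities` is forced
set_option linter.dupNamespace false

noncomputable section

open CategoryTheory Module IsLocalRing

universe u

namespace Summit.ResolutionOfSingularities.ResolutionOfSingularities.Theorems.NoZeno.SandwichCluster

variable {R : Type u} [CommRing R]

/-! ## Two dimension shifts -/

/-- Over any commutative ring: if `φ : F₁ → F₀` is a linear map between PROJECTIVE modules and the
cokernel `F₀ ⧸ range φ` has projective dimension `≤ 2` (`HasProjectiveDimensionLT _ 3`), then `ker φ`
is a projective module — the two short exact sequences `0 → range φ → F₀ → coker φ → 0` and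
`0 → ker φ → F₁ → range φ → 0` shift the projective dimension down twice.
[cite: BrunsHerzog1998, Prop. 1.4.1 (proof); folklore] -/
theorem projective_ker_of_hasProjectiveDimensionLT_three
    {F₁ F₀ : Type u} [AddCommGroup F₁] [Module R F₁] [AddCommGroup F₀] [Module R F₀]
    [Module.Projective R F₁] [Module.Projective R F₀] (φ : F₁ →ₗ[R] F₀)
    (h : HasProjectiveDimensionLT (ModuleCat.of R (F₀ ⧸ LinearMap.range φ)) 3) :
    Module.Projective R (LinearMap.ker φ) := by
  -- `0 → range φ → F₀ → F₀ ⧸ range φ → 0`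
  have hS₀ := LinearMap.shortExact_shortComplexKer
    (Submodule.mkQ_surjective (LinearMap.range φ))
  have hP₀ : Projective (ModuleCat.of R F₀) := inferInstance
  have h₁ : HasProjectiveDimensionLT
      (ModuleCat.of R (LinearMap.ker (LinearMap.range φ).mkQ)) 2 :=
    hS₀.hasProjectiveDimensionLT_X₁ 2 inferInstance h
  -- `ker mkQ = range φ`, and `φ.rangeRestrict : F₁ → range φ` is surjective
  have e : LinearMap.ker (LinearMap.range φ).mkQ = LinearMap.range φ := Submodule.ker_mkQ _
  let ψ : F₁ →ₗ[R] LinearMap.ker (LinearMap.range φ).mkQ :=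
    (LinearEquiv.ofEq _ _ e.symm).toLinearMap ∘ₗ φ.rangeRestrict
  have hψ : Function.Surjective ψ :=
    (LinearEquiv.ofEq _ _ e.symm).surjective.comp φ.surjective_rangeRestrict
  have hS₁ := LinearMap.shortExact_shortComplexKer hψ
  have hP₁ : Projective (ModuleCat.of R F₁) := inferInstance
  have h₀ : HasProjectiveDimensionLT (ModuleCat.of R (LinearMap.ker ψ)) 1 :=
    hS₁.hasProjectiveDimensionLT_X₁ 1 inferInstance h₁
  have hkψ : LinearMap.ker ψ = LinearMap.ker φ := by
    ext x
    simp only [ψ, LinearMap.mem_ker, LinearMap.coe_comp, LinearEquiv.coe_coe, Function.comp_apply,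
      map_eq_zero_iff _ (LinearEquiv.injective _)]
    rw [← Subtype.coe_inj, LinearMap.codRestrict_apply]
    rfl
  have : Projective (ModuleCat.of R (LinearMap.ker ψ)) := inferInstance
  have : Module.Projective R (LinearMap.ker ψ) :=
    (ModuleCat.of R (LinearMap.ker ψ)).projective_of_module_projective
  exact Module.Projective.of_equiv (LinearEquiv.ofEq _ _ hkψ)

/-! ## Regular local rings of dimension `≤ d`: finite modules have projective dimension `≤ d` -/

/-- Over a regular local ring of Krull dimension `≤ d` every finite module has projective dimension
`≤ d`: Matsumura Thm. 19.2 (I) (`hasProjectiveDimensionLE_length_of_isWeaklyRegular`, tree) applied to a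
regular system of parameters, which is an `R`-sequence of length `dim R` generating `𝔪`
(`exists_isRegular_ofList_eq_maximalIdeal`, tree). [cite: Matsumura1987, Thm. 19.2] -/
theorem hasProjectiveDimensionLE_of_isRegularLocalRing [IsRegularLocalRing R] {d : ℕ}
    (hdim : ringKrullDim R ≤ d) (M : Type u) [AddCommGroup M] [Module R M] [Module.Finite R M] :
    HasProjectiveDimensionLE (ModuleCat.of R M) d := by
  obtain ⟨rs, hreg, hspan, hlen⟩ :=
    Literature.AlgebraicGeometry.Resolution.exists_isRegular_ofList_eq_maximalIdeal (R := R)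
  have hpd := Literature.AlgebraicGeometry.Resolution.hasProjectiveDimensionLE_length_of_isWeaklyRegular
    (R := R) hreg.toIsWeaklyRegular hspan (ModuleCat.of R M)
  have hle : rs.length ≤ d := by
    have h' : ((rs.length : ℕ∞) : WithBot ℕ∞) ≤ ((d : ℕ∞) : WithBot ℕ∞) := by
      rw [show ((rs.length : ℕ∞) : WithBot ℕ∞) = (rs.length : WithBot ℕ∞) from rfl, hlen]
      exact hdim
    exact_mod_cast h'
  exact hasProjectiveDimensionLT_of_ge (ModuleCat.of R M) (rs.length + 1) (d + 1) (by omega)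

/-! ## Second syzygies, duals and reflexive modules are free -/

/-- SECOND SYZYGIES ARE FREE: over a regular local ring of Krull dimension `≤ 2`, the kernel of a
linear map between finite free modules is a (finite) free module. [cite: BrunsHerzog1998, Thm. 2.2.7
and Prop. 1.4.1; folklore (Auslander–Buchsbaum–Serre)] -/
theorem free_ker_of_isRegularLocalRing [IsRegularLocalRing R] (hdim : ringKrullDim R ≤ 2)
    {F₁ F₀ : Type u} [AddCommGroup F₁] [Module R F₁] [AddCommGroup F₀] [Module R F₀]
    [Module.Finite R F₁] [Module.Free R F₁] [Module.Finite R F₀] [Module.Free R F₀]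
    (φ : F₁ →ₗ[R] F₀) : Module.Free R (LinearMap.ker φ) := by
  have hpd : HasProjectiveDimensionLT (ModuleCat.of R (F₀ ⧸ LinearMap.range φ)) 3 :=
    hasProjectiveDimensionLE_of_isRegularLocalRing (d := 2) hdim (F₀ ⧸ LinearMap.range φ)
  have : Module.Projective R (LinearMap.ker φ) :=
    projective_ker_of_hasProjectiveDimensionLT_three φ hpd
  exact Module.free_of_flat_of_isLocalRing

/-- DUALS ARE FREE: over a regular local ring of Krull dimension `≤ 2`, the dual `Hom_R(M, R)` of every
finite module `M` is free — for a finite presentation `Q → P → M → 0` the dual `M*` is the kernel of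
`P* → Q*` (left exactness of `Hom(-, R)`), a second syzygy. [cite: BrunsHerzog1998, Prop. 1.4.1;
folklore] -/
theorem free_dual_of_isRegularLocalRing [IsRegularLocalRing R] (hdim : ringKrullDim R ≤ 2)
    (M : Type u) [AddCommGroup M] [Module R M] [Module.Finite R M] :
    Module.Free R (Module.Dual R M) := by
  -- a finite presentation `Q —g→ P —f→ M → 0`
  obtain ⟨P, _, _, _, _, f, hf⟩ := Module.exists_finite_presentation R M
  obtain ⟨Q, _, _, _, _, q, hq⟩ := Module.exists_finite_presentation R (LinearMap.ker f)
  let g : Q →ₗ[R] P := (LinearMap.ker f).subtype ∘ₗ q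
  have hrange : LinearMap.range g = LinearMap.ker f := by
    rw [LinearMap.range_comp, LinearMap.range_eq_top.mpr hq, Submodule.map_top,
      Submodule.range_subtype]
  -- `M* ≅ range f* = (ker f)^⊥ = (range g)^⊥ = ker g*`
  have hker : LinearMap.ker g.dualMap = LinearMap.range f.dualMap := by
    rw [LinearMap.ker_dualMap_eq_dualAnnihilator_range, hrange,
      LinearMap.range_dualMap_eq_dualAnnihilator_ker_of_surjective f hf]
  have e : Module.Dual R M ≃ₗ[R] LinearMap.ker g.dualMap :=
    (LinearEquiv.ofInjective f.dualMap (LinearMap.dualMap_injective_of_surjective hf)).trans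
      (LinearEquiv.ofEq _ _ hker.symm)
  have : Module.Free R (LinearMap.ker g.dualMap) := free_ker_of_isRegularLocalRing hdim g.dualMap
  exact Module.Free.of_equiv e.symm

/-- **(F0) REFLEXIVE MODULES ARE FREE**: over a regular local ring of Krull dimension `≤ 2`, every
finite reflexive module (`Module.IsReflexive R M`: the evaluation map `M → M**` is bijective) is free —
`M ≅ M** = (M*)*` is the dual of the finite module `M*`.  This is the algebra behind «every reflexive
coherent sheaf on a regular surface is locally free», used by the G-layer of THEOREM A at the sky points
(two-dimensional regular local rings) of a sandwiched stage. [cite: BrunsHerzog1998, Prop. 1.4.1;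
folklore (Auslander–Buchsbaum–Serre)] -/
theorem free_of_isReflexive_of_isRegularLocalRing [IsRegularLocalRing R] (hdim : ringKrullDim R ≤ 2)
    (M : Type u) [AddCommGroup M] [Module R M] [Module.Finite R M] [Module.IsReflexive R M] :
    Module.Free R M := by
  have : Module.Free R (Module.Dual R (Module.Dual R M)) :=
    free_dual_of_isRegularLocalRing hdim (Module.Dual R M)
  exact Module.Free.of_equiv (Module.evalEquiv R M).symm

end Summit.ResolutionOfSingularities.ResolutionOfSingularities.Theorems.NoZeno.SandwichCluster

end
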